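import Mathlib
import Literature.Analysis.FluidPDE.Tao2016AveragedNS.RestartedCascadeFlows
import Summits.NavierStokesRegularity.NavierStokesRegularity.Theses.TaoLadderRungThree
import HarnessLib

/-!
# `GappedFrontRobust`, (front) clause: INERT PHANTOM FRONT (helper for item
  stmt-NavierStokesRegularity-20423, crux K_B of routes TaoLadderRungThree / TaoLadderRungTwo;
  the registered skeleton's `stub_inertPhantomFront` with its skeleton-local predicate `SlackDecay`
  UNFOLDED)

HONEST FRAMING: an elementary bookkeeping lemma about Tao-type MODEL lattice pseudo-flows (Tao 2016,
§4 (4.5), (4.8)–(4.10): an exact solution carrying inert phantom energy is still a defect-free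
pseudo-flow), in the cell vocabulary `TaoCascade.GapData` / `FrontExists` / `PseudoFlowOn` /
`slackWeight` of the tree module `RestartedCascadeFlows`. Nothing here is a statement about the
Navier–Stokes equations and nothing is asserted about any table: it is an implication from gap data.

**Statement.** For every gap datum `GapData ε₀ i₀ α X₀ Z w r ρ θ₀ θ c₀ c env₀`, every margin `η > 0`
and every epoch envelope `env` whose slack weights are admissible against the (4.5) weight
(`∀ L, ∃ C, ∀ k, (1+(1+ε₀)^{10k}) √(slackWeight ε₀ θ c env L k) ≤ C` — the skeleton's `SlackDecay`),
the (front) clause `FrontExists ε₀ θ c η α (ballDesc Z w r) env` holds.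

PROOF. Given a ball state `S₀` with slack `0 ≤ B₀ ≤ η·slackWeight L` and start energies
`½S₀² ≤ F₀ ≤ ½S₀² + B₀`, take the EXACT zero-slack flow `(S, F)` on `[0, c]` supplied by the gap
datum's clause (exist₀) (the ball description does not see energies) and carry the inert phantom energy
`φ := F₀ − ½S₀² ∈ [0, B₀]` as a constant offset: `F' := F + φ`. Regularity, the equation of motion
(defect `0`) and the energy inequality (`∂(F + φ) = ∂F`) are unchanged; `½S² ≤ F ≤ F'`;
`F' ≤ ½S² + φ ≤ ½S² + B₀`; `F'(0) = F₀`; and the (4.5) weight of `√F' ≤ √F + √φ` is bounded because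
`(1+(1+ε₀)^{10k})√φ ≤ √η · (1+(1+ε₀)^{10k})√(slackWeight L k) ≤ √η · C`.
-/

noncomputable section

-- the sub-problem namespace `Summit.NavierStokesRegularity.NavierStokesRegularity` repeats the summit name by design (D-0017)
set_option linter.dupNamespace false

namespace Summit.NavierStokesRegularity.NavierStokesRegularity.Theorems

open Set MeasureTheory intervalIntegral Literature.Analysis.FluidPDE Literature.Analysis.FluidPDE.TaoCascade

namespace GappedFrontRobust

/-- `√(a + b) ≤ √a + √b`. [folklore] -/
theorem sqrt_add_le' (a b : ℝ) : Real.sqrt (a + b) ≤ Real.sqrt a + Real.sqrt b := by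
  rcases le_or_gt 0 a with ha | ha
  · rcases le_or_gt 0 b with hb | hb
    · have h1 : a + b ≤ (Real.sqrt a + Real.sqrt b) ^ 2 := by
        nlinarith [Real.sq_sqrt ha, Real.sq_sqrt hb, Real.sqrt_nonneg a, Real.sqrt_nonneg b]
      calc Real.sqrt (a + b) ≤ Real.sqrt ((Real.sqrt a + Real.sqrt b) ^ 2) := Real.sqrt_le_sqrt h1
        _ = Real.sqrt a + Real.sqrt b := Real.sqrt_sq (by positivity)
    · calc Real.sqrt (a + b) ≤ Real.sqrt a := Real.sqrt_le_sqrt (by linarith)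
        _ ≤ Real.sqrt a + Real.sqrt b := le_add_of_nonneg_right (Real.sqrt_nonneg b)
  · calc Real.sqrt (a + b) ≤ Real.sqrt b := Real.sqrt_le_sqrt (by linarith)
      _ ≤ Real.sqrt a + Real.sqrt b := le_add_of_nonneg_left (Real.sqrt_nonneg a)

/-- **An exact flow carrying inert phantom energy is a defect-free pseudo-flow**: if `(S, F)` is a
zero-slack defect-free flow on `[0, τ]` from `(S₀, ½S₀²)` and `0 ≤ φ ≤ B₀` with the (4.5) weight of
`√φ` bounded, then `(S, F + φ)` is a defect-free flow from `(S₀, ½S₀² + φ)` with slack `B₀`.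
[cite: Tao2016AveragedNS, §4 Lemma 4.1 (4.5), (4.8)–(4.10)] -/
theorem pseudoFlowOn_add_phantom {τ ε₀ : ℝ} {m : ℕ} {α : Fin m → Fin m → Fin m → ℤ × ℤ × ℤ → ℝ}
    {S₀ B₀ φ : Fin m → ℤ → ℝ} {S F : Fin m → ℤ → ℝ → ℝ}
    (hq : 0 < 1 + ε₀)
    (h : PseudoFlowOn τ ε₀ α 0 0 S₀ (fun i k => (1 / 2) * S₀ i k ^ 2) (fun _ _ => 0) S F)
    (hφ0 : ∀ i k, 0 ≤ φ i k) (hφB : ∀ i k, φ i k ≤ B₀ i k)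
    (hφw : ∃ C : ℝ, ∀ (i : Fin m) (k : ℤ), (1 + (1 + ε₀) ^ ((10 : ℝ) * k)) * Real.sqrt (φ i k) ≤ C) :
    PseudoFlowOn τ ε₀ α 0 0 S₀ (fun i k => (1 / 2) * S₀ i k ^ 2 + φ i k) B₀ S
      (fun i k s => F i k s + φ i k) where
  contDiffOn_S := h.contDiffOn_S
  contDiffOn_F i k := (h.contDiffOn_F i k).add contDiffOn_const
  nonneg_F i k s hs := add_nonneg (h.nonneg_F i k s hs) (hφ0 i k)
  apriori_S := h.apriori_S
  apriori_F := by
    obtain ⟨M, hM⟩ := h.apriori_F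
    obtain ⟨C, hC⟩ := hφw
    refine ⟨M + C, fun s hs i k => ?_⟩
    have hw : 0 ≤ 1 + (1 + ε₀) ^ ((10 : ℝ) * k) := by
      have := Real.rpow_pos_of_pos hq ((10 : ℝ) * k)
      linarith
    calc (1 + (1 + ε₀) ^ ((10 : ℝ) * k)) * Real.sqrt (F i k s + φ i k)
        ≤ (1 + (1 + ε₀) ^ ((10 : ℝ) * k)) * (Real.sqrt (F i k s) + Real.sqrt (φ i k)) :=
          mul_le_mul_of_nonneg_left (sqrt_add_le' _ _) hw
      _ = (1 + (1 + ε₀) ^ ((10 : ℝ) * k)) * Real.sqrt (F i k s) +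
            (1 + (1 + ε₀) ^ ((10 : ℝ) * k)) * Real.sqrt (φ i k) := by ring
      _ ≤ M + C := add_le_add (hM s hs i k) (hC i k)
  init_S := h.init_S
  init_F i k := by rw [h.init_F i k]
  motion i k s hs := by
    have h1 := h.motion i k s hs
    simp only [zero_mul] at h1 ⊢
    exact h1
  energy i k s hs := by
    rw [derivWithin_add_const]
    exact h.energy i k s hs
  defect_lower i k s hs := (h.defect_lower i k s hs).trans (le_add_of_nonneg_right (hφ0 i k))
  defect_upper i k s hs := by
    have h1 := h.defect_upper i k s hs
    simp only [zero_mul, add_zero] at h1 ⊢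
    linarith [hφB i k]

/-- **Inert phantom front** (the (front) clause of `GappedFrontRobust` for every margin `η > 0` and
every envelope with admissible slack weights; general number of modes): from gap data, defect-free
flows exist on the whole clock window `[0, c]` from every ball state with admissible slack and
compatible start energies. [cite: Tao2016AveragedNS, §4 Lemma 4.1 (4.5), (4.8)–(4.10); cell vocabulary `GapData` (exist₀)] -/
theorem frontExists_of_gapData {ε₀ : ℝ} {m : ℕ} {i₀ : Fin m}
    {α : Fin m → Fin m → Fin m → ℤ × ℤ × ℤ → ℝ} {X₀ : Fin m → ℝ} {Z : Set (Fin m → ℤ → ℝ)}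
    {w : ℤ → ℝ} {r ρ θ₀ θ c₀ c : ℝ} {env₀ : ℤ → ℝ} (hε₀ : 0 < ε₀)
    (hgap : GapData ε₀ i₀ α X₀ Z w r ρ θ₀ θ c₀ c env₀) {η : ℝ} {env : ℤ → ℝ} (hη : 0 < η)
    (hdec : ∀ L : ℕ, ∃ C : ℝ, ∀ k : ℤ,
      (1 + (1 + ε₀) ^ ((10 : ℝ) * k)) * Real.sqrt (slackWeight ε₀ θ c env L k) ≤ C) :
    FrontExists ε₀ θ c η α (ballDesc Z w r) env := by
  intro L S₀ F₀ B₀ hball hB hF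
  have hq : (0 : ℝ) < 1 + ε₀ := by linarith
  obtain ⟨-, -, -, -, -, -, -, -, -, -, -, hex, -⟩ := hgap
  obtain ⟨z, hz, hzr⟩ := hball
  obtain ⟨S, F, hSF⟩ := hex S₀ ⟨z, hz, hzr⟩
  obtain ⟨C, hC⟩ := hdec L
  -- the inert phantom energy `φ = F₀ − ½S₀² ∈ [0, B₀]`
  set φ : Fin m → ℤ → ℝ := fun i k => F₀ i k - (1 / 2) * S₀ i k ^ 2 with hφ
  have hφ0 : ∀ i k, 0 ≤ φ i k := fun i k => by have := (hF i k).1; simp only [hφ]; linarith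
  have hφB : ∀ i k, φ i k ≤ B₀ i k := fun i k => by have := (hF i k).2; simp only [hφ]; linarith
  have hφw : ∃ C' : ℝ, ∀ (i : Fin m) (k : ℤ),
      (1 + (1 + ε₀) ^ ((10 : ℝ) * k)) * Real.sqrt (φ i k) ≤ C' := by
    refine ⟨Real.sqrt η * C, fun i k => ?_⟩
    have hw : 0 ≤ 1 + (1 + ε₀) ^ ((10 : ℝ) * k) := by
      have := Real.rpow_pos_of_pos hq ((10 : ℝ) * k)
      linarith
    have h1 : Real.sqrt (φ i k) ≤ Real.sqrt η * Real.sqrt (slackWeight ε₀ θ c env L k) := by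
      rw [← Real.sqrt_mul hη.le]
      exact Real.sqrt_le_sqrt ((hφB i k).trans (hB i k).2)
    calc (1 + (1 + ε₀) ^ ((10 : ℝ) * k)) * Real.sqrt (φ i k)
        ≤ (1 + (1 + ε₀) ^ ((10 : ℝ) * k)) *
            (Real.sqrt η * Real.sqrt (slackWeight ε₀ θ c env L k)) :=
          mul_le_mul_of_nonneg_left h1 hw
      _ = Real.sqrt η *
            ((1 + (1 + ε₀) ^ ((10 : ℝ) * k)) * Real.sqrt (slackWeight ε₀ θ c env L k)) := by ring
      _ ≤ Real.sqrt η * C := mul_le_mul_of_nonneg_left (hC k) (Real.sqrt_nonneg η)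
  have hflow := pseudoFlowOn_add_phantom hq hSF hφ0 hφB hφw
  -- the start energies `½S₀² + φ = F₀`
  have hF₀ : (fun i k => (1 / 2) * S₀ i k ^ 2 + φ i k) = F₀ := by
    funext i k; simp only [hφ]; ring
  rw [hF₀] at hflow
  exact ⟨S, _, hflow⟩

/-- **The registered stub `stub_inertPhantomFront` of the K_B skeleton on item
stmt-NavierStokesRegularity-20423, with its skeleton-local predicate `SlackDecay ε₀ θ c env` spelled
out** (`∀ L, ∃ C, ∀ k, (1+(1+ε₀)^{10k}) √(slackWeight ε₀ θ c env L k) ≤ C`): inside the skeleton the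
stub is then `exact inertPhantomFront …`. [cite: Tao2016AveragedNS, §4 Lemma 4.1 (4.5), (4.8)–(4.10); cell vocabulary] -/
theorem inertPhantomFront :
    ∀ (R ε₀ : ℝ) (i₀ : Fin 4) (α : Fin 4 → Fin 4 → Fin 4 → ℤ × ℤ × ℤ → ℝ) (X₀ : Fin 4 → ℝ)
    (Z : Set (Fin 4 → ℤ → ℝ)) (w : ℤ → ℝ) (r ρ θ₀ θ c₀ c : ℝ) (env₀ : ℤ → ℝ),
    InTableClass R α → 0 < ε₀ → GapData ε₀ i₀ α X₀ Z w r ρ θ₀ θ c₀ c env₀ →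
      ∀ (η : ℝ) (env : ℤ → ℝ), 0 < η →
        (∀ L : ℕ, ∃ C : ℝ, ∀ k : ℤ,
          (1 + (1 + ε₀) ^ ((10 : ℝ) * k)) * Real.sqrt (slackWeight ε₀ θ c env L k) ≤ C) →
        FrontExists ε₀ θ c η α (ballDesc Z w r) env :=
  fun _R _ε₀ _i₀ _α _X₀ _Z _w _r _ρ _θ₀ _θ _c₀ _c _env₀ _hα hε₀ hgap _η _env hη hdec =>
    frontExists_of_gapData hε₀ hgap hη hdec

end GappedFrontRobust

end Summit.NavierStokesRegularity.NavierStokesRegularity.Theorems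

end
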